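import Summits.QuantumFields.YangMills.Theorems.AlphaInputsT3ACv4RecordSelXs
import HarnessLib

/-!
# `AlphaInputsT3ACv4ChiB3PinnedOfSelXsRows` — WHAT THE 19936 REGISTRY ROWS `(hT8) (hrows)` DELIVER WITH THE [7] CONSTANTS PINNED FIRST:
# a `B₃`-UNIFORM v4 χ-PACKAGE FAMILY — `∃ B a₀ a₁` (per odd `L > 1`, BEFORE the profile thresholds `(b₁, p₁)`), then for EVERY profile `(b₀, p₀) ≥ (b₁, p₁)` a record `𝔠`
# with `𝔠.b₀ = b₀`, `𝔠.p₀ = p₀`, `𝔠.B₃ = B`, the three `C68`-rows, the seam row (71)_sym and `AlphaInputsT3AC.OfV4ChiAt F (hF ▸ 𝔠) a₀ a₁` for every family `F` of block size `L`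

Cell `ym3-torus` (YM ladder rung R3 = continuum SU(2) Yang–Mills on T³ — a RUNG, NOT d = 4, NOT infinite volume, NOT a mass gap, NOT the Clay problem); twin-width seat
`ym-ust-19936-w8` (gen 14) on crux `HistoryTailL` (stmt-QuantumFields-19936), `--supports stmt-QuantumFields-19936 --as helper`, count-neutral.  THEOREMS ONLY (0 `def`, 0 `sorry`,
default heartbeats).

WHY (★★OWNER ym3-torus-plan g35 RULING №44 «SOCKET OF RECORD» (iii) as SHARPENED 2026-08-30 09:57Z∕10:00Z on ym-ust-20520-w5 g18's LOCATE «B₃-uniformity»).  The 19936 registry of record v6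
{EX `stub_existenceMinimalOrbit`, (O‴χₛ) `stub_selXsV4DataRows`} delivers the v4 χ-socket through ✓`HistoryTailSelSupplier.laneRecordsV4Chi_of_thm1In8_selXsDataRows_allL (hT8) (hrows) :
∀ L, Odd L → 1 < L → AlphaInputsT3ACv4RecChi L` (`AlphaInputsT3ACv4RecordSelXs` :365).  That packaging FORGETS a letter the supplier proves: inside
✓`pinnedPartsT3ACRecSelXsV4Chi_of_thm1_rows` (:318–345) the [7] constants `B := max (max B₃ᵀ B₀) ½`, `a₀`, `a₁` are fixed from `hT`∕`hrows`'s letters BEFORE the thresholds `(b₁, p₁)`, and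
`hrows` returns `𝔠.B₃ = B` for EVERY profile — print's «`B₃ = B₃(d, L)`» ([Balaban1985Variational] Thm 1) — whereas `AlphaInputsT3ACv4RecChi L` (`…v4Chi.lean` :75) re-quantifies
`∃ 𝔠 a₀ a₁` PER profile with no `B`-letter.  The 20520 lane's χ∕rows capstone for LOWB∘ VERBATIM (window `PlaqSmall (θBal F.L γ b₀ p₀ n)` at the CALLER's profile, served from the
interior window `θBal∕max B₃ 1` by the profile shift `θBal(b₀,p₀,n) = θBal(B′·b₀,p₀,n)∕B′`, `B′ := max B 1` FIXED PER `L`) needs exactly this uniformity (LEAD w3-20520 g19 09:59:54Z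
quantifier note; OWNER 10:00:25Z «(β) — but PROVED, not hypothesised»).  THIS FILE proves it once, as a door out of the 19936 rows, so the capstone imports it instead of re-running :365.
* §1 ★★ `exists_B3pinned_ofV4ChiAt_of_thm1_rows` — per block size `L > 1`: from (T) `∃ a₀ a₁ B₃ > 0, Thm1GlobalMinAt L a₀ a₁ B₃` and the per-`L` body of `hrows` (floor `B₀`, box
  `(0, A₀] × (0, A₁]`): `∃ B a₀ a₁` with the small-`a₁` windows, `1 ≤ 2B`, `Thm1GlobalMinAt L a₀ a₁ B`, and `∃ b₁ p₁ ∀ (b₀,p₀) ≥ (b₁,p₁) ∃ 𝔠` with `𝔠.b₀ = b₀ ∧ 𝔠.p₀ = p₀ ∧ 𝔠.B₃ = B`,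
  the three `C68`-rows, and per family (71)_sym ∧ `OfV4ChiAt F (hF ▸ 𝔠) a₀ a₁` — the proof of :318 with `B a₀ a₁` kept OUTSIDE the profile quantifiers, then
  ✓`AlphaInputsT3AC.ofV4ChiAt_of_pinnedPartsSelXsChi_cast` per profile.
* §2 ★★★ `B3pinned_ofV4ChiAt_allL_of_thm1In8_selXsDataRows` — at every odd `L > 1`, from EXACTLY the two binders `(hT8) (hrows)` of ✓`laneRecordsV4Chi_of_thm1In8_selXsDataRows_allL`
  (= the R3 certificate ✓p758552's `hEX`-descendant (T8) and the registered (O‴χₛ) text VERBATIM).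
* §3 ★ `alphaInputsT3ACv4RecChi_of_B3pinned` — forgetting `B` recovers the opaque socket `AlphaInputsT3ACv4RecChi L` (consistency with :365; one line).
HONEST SCOPE.  A re-packaging of landed glue (no analysis); (T8) and (O‴χₛ) are DISPLAYED hypotheses — the content of [Balaban1985Variational] Thm 1 ∕ Prop. 8 and of [Balaban1985UV3]
Sect. B–C for the pinned averaging — NOT proved here; nothing of `HistoryTailL` (19936), EX, 19200, 20520 (`FluctuationComparisonRegPrIntL`, UP∘∕LOWB∘∕PERS₁∘∕TUBE∘) or the rung
`YM3TorusSU2` is proved by this file; no summit statement is proved by a width seat; the Yang–Mills mass gap is NOT proved.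

References: T. Bałaban, Commun. Math. Phys. **102** (1985) 255–275 [Balaban1985UV3] ((7) p.257, (40)–(42) p.266, (47) p.267, (67)–(71) p.273, Thm 2 p.272); T. Bałaban,
Commun. Math. Phys. **102** (1985) 277–309 [Balaban1985Variational] (Thm 1 (6)–(8) pp.278–279, Prop. 8 p.304).
-/

set_option autoImplicit false

noncomputable section

namespace Summit.QuantumFields.YangMills.Theorems.AlphaInputsT3ACv4ChiB3Pinned

open MeasureTheory Set
open scoped Matrix.Norms.L2Operator
open Literature.MathematicalPhysics.QuantumFieldTheory.Balaban1983to89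
open Literature.MathematicalPhysics.QuantumFieldTheory.Balaban1983to89.T3ContinuumYM3Torus
open Literature.MathematicalPhysics.QuantumFieldTheory.Balaban1983to89.T3PrintedMinimiserExistence (Thm1GlobalMinAt)
open Literature.MathematicalPhysics.QuantumFieldTheory.Balaban1983to89.T3LowerAlongMinimisersSplit (MinimisersIn8At)
open Literature.MathematicalPhysics.QuantumFieldTheory.Balaban1983to89.ExpMeanLog (deltaSU)
open Literature.MathematicalPhysics.QuantumFieldTheory.Balaban1985CMP102.Setting
open Summit.QuantumFields.Balaban3D.Carriers
open Summit.QuantumFields.Balaban3D.Proofs.Primitives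
open Summit.QuantumFields.Balaban3D.Proofs.Thresholds (Q0 Q0_pos)
open Summit.QuantumFields.YangMills.Theorems.HistoryTailOneSupplier (exists_small_window)
open Literature.MathematicalPhysics.QuantumFieldTheory.Balaban1983to89.B7Prop2Explicit (C0 C0_pos)

/-! ## §1 Per block size: the [7] constants `B, a₀, a₁` pinned before the profile thresholds -/

/-- ★★ **A `B₃`-UNIFORM v4 χ-PACKAGE FAMILY FROM (T) AND THE PER-`L` (O‴χₛ) SUPPLIER ROWS.**  From [Balaban1985Variational] Thm 1 at some constants (`hT`) and the per-`L` body of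
the registered (O‴χₛ) row (floor `B₀`, box `(0, A₀] × (0, A₁]`; `hrows` VERBATIM the binder of ✓`pinnedPartsT3ACRecSelXsV4Chi_of_thm1_rows`): there are `B a₀ a₁` — chosen ONCE, `B :=
max (max B₃ᵀ B₀) ½`, `(a₀, a₁)` by ✓`exists_small_window` — with `0 < a₀`, `0 < a₁`, `B·a₁ ≤ a₀`, the two small-`a₁` windows, `1 ≤ 2B`, `Thm1GlobalMinAt L a₀ a₁ B`
(✓`thm1GlobalMinAt_anti`∕`_mono`), and thresholds `(b₁, p₁)` such that EVERY profile beyond them carries a record `𝔠` with `𝔠.b₀ = b₀`, `𝔠.p₀ = p₀`, `𝔠.B₃ = B`, the three `C68`-rows,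
and for every family `F` with `F.L = L` the seam row (71)_sym at every `(γ, K)` AND `AlphaInputsT3AC.OfV4ChiAt F (hF ▸ 𝔠) a₀ a₁` (✓`ofV4ChiAt_of_pinnedPartsSelXsChi_cast`).
[cite: Balaban1985Variational, Thm 1 (6)-(8) pp.278-279; Balaban1985UV3, (7) p.257, (40)-(42) p.266, (47) p.267, (67)-(71) p.273, Thm 2 p.272] -/
theorem exists_B3pinned_ofV4ChiAt_of_thm1_rows {L : ℕ} (hL : 1 < L)
    (hT : ∃ a₀ a₁ B₃ : ℝ, 0 < a₀ ∧ 0 < a₁ ∧ 0 < B₃ ∧ Thm1GlobalMinAt L a₀ a₁ B₃)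
    {B₀ A₀ A₁ : ℝ} (hA₀ : 0 < A₀) (hA₁ : 0 < A₁)
    (hrows : ∀ (B a₀ a₁ : ℝ), B₀ ≤ B → 1 ≤ 2 * B → 0 < a₀ → a₀ ≤ A₀ → 0 < a₁ → a₁ ≤ A₁ → B * a₁ ≤ a₀ →
      (143 * ((((3 + 4 : ℕ) : ℝ)) ^ 2 / 4) ^ 2) * (2 * (B * a₁)) ≤ 1 / 3 →
      2 * (2 * (B * a₁)) ≤ 2 * deltaSU (Fin 2) / (((3 + 4) * L : ℕ) : ℝ) ^ 2 →
      Thm1GlobalMinAt L a₀ a₁ B →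
      ∃ (b₁ p₁ : ℝ), ∀ (b₀ p₀ : ℝ), b₁ ≤ b₀ → p₁ ≤ p₀ →
        ∃ 𝔠 : AlphaConsts L (suGroupModel 2).N, 𝔠.b₀ = b₀ ∧ 𝔠.p₀ = p₀ ∧ 𝔠.B₃ = B ∧
          4 * 𝔠.B₃ * (L : ℝ) ^ 2 * avgWindowFactor L ≤ 𝔠.C68 ∧
          Real.exp (𝔠.p₀ - 1) ≤ 3 * C0 3 * 𝔠.C68 * (𝔠.b₀ * Q0 𝔠.p₀) ∧
          (𝔠.b₀ * Q0 𝔠.p₀) * (2 * (L : ℝ) ^ 2 * avgWindowFactor L) ^ 2 ≤ 3 * C0 3 * 𝔠.C68 * a₁ ^ 2 ∧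
          ∀ (F : T3Family) (hF : F.L = L),
            (∀ (γ : ℝ) (hγ : 0 < γ) (hγ1 : γ ≤ (min (hF ▸ 𝔠).gamma0 1) ^ 2) (K : ℕ),
              AlphaInputsT3AC.SmallFactor71OfRecT3 F (hF ▸ 𝔠) γ hγ hγ1 K) ∧
            ∀ (γ : ℝ) (hγ : 0 < γ) (hγ1 : γ ≤ (min (hF ▸ 𝔠).gamma0 1) ^ 2) (K : ℕ),
              (∃ Ut : (k : ℕ) → GaugeField (F.P K) k (Matrix.specialUnitaryGroup (Fin 2) ℂ) →
                  GaugeField (F.P K) 0 (Matrix.specialUnitaryGroup (Fin 2) ℂ),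
                AlphaInputsT3AC.TrivMinimiserRowsT3 F (hF ▸ 𝔠) γ hγ hγ1 a₀ a₁ K Ut) →
              ∃ Ut : (k : ℕ) → GaugeField (F.P K) k (Matrix.specialUnitaryGroup (Fin 2) ℂ) →
                  GaugeField (F.P K) 0 (Matrix.specialUnitaryGroup (Fin 2) ℂ),
                AlphaInputsT3AC.TrivMinimiserRowsT3 F (hF ▸ 𝔠) γ hγ hγ1 a₀ a₁ K Ut ∧
                  AlphaInputsT3AC.DataRowsT3XsChiSel F (hF ▸ 𝔠) γ hγ hγ1 K Ut) :
    ∃ (B a₀ a₁ : ℝ), 0 < a₀ ∧ 0 < a₁ ∧ B * a₁ ≤ a₀ ∧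
      (143 * ((((3 + 4 : ℕ) : ℝ)) ^ 2 / 4) ^ 2) * (2 * (B * a₁)) ≤ 1 / 3 ∧
      2 * (2 * (B * a₁)) ≤ 2 * deltaSU (Fin 2) / (((3 + 4) * L : ℕ) : ℝ) ^ 2 ∧
      1 ≤ 2 * B ∧ Thm1GlobalMinAt L a₀ a₁ B ∧
      ∃ (b₁ p₁ : ℝ), ∀ (b₀ p₀ : ℝ), b₁ ≤ b₀ → p₁ ≤ p₀ →
        ∃ 𝔠 : AlphaConsts L (suGroupModel 2).N, 𝔠.b₀ = b₀ ∧ 𝔠.p₀ = p₀ ∧ 𝔠.B₃ = B ∧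
          4 * 𝔠.B₃ * (L : ℝ) ^ 2 * avgWindowFactor L ≤ 𝔠.C68 ∧
          Real.exp (𝔠.p₀ - 1) ≤ 3 * C0 3 * 𝔠.C68 * (𝔠.b₀ * Q0 𝔠.p₀) ∧
          (𝔠.b₀ * Q0 𝔠.p₀) * (2 * (L : ℝ) ^ 2 * avgWindowFactor L) ^ 2 ≤ 3 * C0 3 * 𝔠.C68 * a₁ ^ 2 ∧
          ∀ (F : T3Family) (hF : F.L = L),
            (∀ (γ : ℝ) (hγ : 0 < γ) (hγ1 : γ ≤ (min (hF ▸ 𝔠).gamma0 1) ^ 2) (K : ℕ),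
              AlphaInputsT3AC.SmallFactor71OfRecT3 F (hF ▸ 𝔠) γ hγ hγ1 K) ∧
            AlphaInputsT3AC.OfV4ChiAt F (hF ▸ 𝔠) a₀ a₁ := by
  obtain ⟨aT₀, aT₁, BT, haT₀, haT₁, hBT, hT⟩ := hT
  set B : ℝ := max (max BT B₀) (1 / 2) with hB_def
  have hBT_le : BT ≤ B := (le_max_left _ _).trans (le_max_left _ _)
  have hB₀_le : B₀ ≤ B := (le_max_right _ _).trans (le_max_left _ _)
  have hBhalf : 1 / 2 ≤ B := le_max_right _ _
  have hBpos : 0 < B := lt_of_lt_of_le (by norm_num) hBhalf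
  have h2B : 1 ≤ 2 * B := by linarith
  obtain ⟨a₀, a₁, ha₀, ha₀A, ha₁, ha₁A, hwin, hA3, hA2⟩ :=
    exists_small_window hL hBpos (lt_min hA₀ haT₀) (lt_min hA₁ haT₁)
  have hT' : Thm1GlobalMinAt L a₀ a₁ B :=
    MinimiserPin.thm1GlobalMinAt_mono
      (MinimiserPin.thm1GlobalMinAt_anti hT (ha₀A.trans (min_le_right _ _)) (ha₁A.trans (min_le_right _ _))) le_rfl hBT_le
  obtain ⟨b₁, p₁, hrec⟩ := hrows B a₀ a₁ hB₀_le h2B ha₀ (ha₀A.trans (min_le_left _ _)) ha₁ (ha₁A.trans (min_le_left _ _))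
    hwin hA3 hA2 hT'
  refine ⟨B, a₀, a₁, ha₀, ha₁, hwin, hA3, hA2, h2B, hT', b₁, p₁, fun b₀ p₀ hb hp => ?_⟩
  obtain ⟨𝔠, h1, h2, hB3, s1, s2, s3, hFO⟩ := hrec b₀ p₀ hb hp
  refine ⟨𝔠, h1, h2, hB3, s1, s2, s3, fun F hF => ⟨(hFO F hF).1, ?_⟩⟩
  exact AlphaInputsT3AC.ofV4ChiAt_of_pinnedPartsSelXsChi_cast ha₁ (by rw [hB3]; exact hwin) (by rw [hB3]; exact hA3)
    (by rw [hB3]; exact hA2) (by rw [hB3]; exact h2B) s1 s2 s3 (by rw [hB3]; exact hT') F hF (hFO F hF).1 (hFO F hF).2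

/-! ## §2 At every odd block size, from exactly the two binders `(hT8) (hrows)` -/

/-- ★★★ **THE `B₃`-PINNED v4 χ-PACKAGE FAMILY AT EVERY ODD `L > 1`, FROM EXACTLY `(hT8) (hrows)`** — the two binders of ✓`laneRecordsV4Chi_of_thm1In8_selXsDataRows_allL` VERBATIM
((T8) = [Balaban1985Variational] Thm 1 + Prop. 8 at every odd `L > 1`, the `hEX`-descendant of the R3 certificate ✓`RungOfExistenceMinimalOrbit.ym3TorusSU2_of_existenceMinimalOrbit_regPrIntL_selXsV4DataRows`;
`hrows` = the 19936 registry v6 row `stub_selXsV4DataRows`): for every odd `L > 1`, §1's conclusion — `B a₀ a₁` BEFORE `(b₁, p₁)`, `𝔠.B₃ = B` at every profile.  This is RULING №44 (iii)'s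
«second form» with the `B`-letter KEPT: the socket the LOWB∘-verbatim ∕ PERS₁∘ ∕ TUBE∘ χ∕rows capstones read. [cite: Balaban1985Variational, Thm 1 (6)-(8) pp.278-279, Prop. 8 p.304; Balaban1985UV3, (5) p.256, (7) p.257, (47) p.267, (67)-(71) p.273, Thm 2 p.272] -/
theorem B3pinned_ofV4ChiAt_allL_of_thm1In8_selXsDataRows
    (hT8 : ∀ L : ℕ, Odd L → 1 < L → ∃ a₀ a₁ B₃ : ℝ, 0 < a₀ ∧ 0 < a₁ ∧ 0 < B₃ ∧
      Thm1GlobalMinAt L a₀ a₁ B₃ ∧ MinimisersIn8At L a₀ a₁ B₃)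
    (hrows : ∀ L : ℕ, Odd L → 1 < L → ∃ (B₀ A₀ A₁ : ℝ), 0 < A₀ ∧ 0 < A₁ ∧
      ∀ (B a₀ a₁ : ℝ), B₀ ≤ B → 1 ≤ 2 * B → 0 < a₀ → a₀ ≤ A₀ → 0 < a₁ → a₁ ≤ A₁ → B * a₁ ≤ a₀ →
        (143 * ((((3 + 4 : ℕ) : ℝ)) ^ 2 / 4) ^ 2) * (2 * (B * a₁)) ≤ 1 / 3 →
        2 * (2 * (B * a₁)) ≤ 2 * deltaSU (Fin 2) / (((3 + 4) * L : ℕ) : ℝ) ^ 2 →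
        Thm1GlobalMinAt L a₀ a₁ B →
        ∃ (b₁ p₁ : ℝ), ∀ (b₀ p₀ : ℝ), b₁ ≤ b₀ → p₁ ≤ p₀ →
          ∃ 𝔠 : AlphaConsts L (suGroupModel 2).N, 𝔠.b₀ = b₀ ∧ 𝔠.p₀ = p₀ ∧ 𝔠.B₃ = B ∧
            4 * 𝔠.B₃ * (L : ℝ) ^ 2 * avgWindowFactor L ≤ 𝔠.C68 ∧
            Real.exp (𝔠.p₀ - 1) ≤ 3 * C0 3 * 𝔠.C68 * (𝔠.b₀ * Q0 𝔠.p₀) ∧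
            (𝔠.b₀ * Q0 𝔠.p₀) * (2 * (L : ℝ) ^ 2 * avgWindowFactor L) ^ 2 ≤ 3 * C0 3 * 𝔠.C68 * a₁ ^ 2 ∧
            ∀ (F : T3Family) (hF : F.L = L),
              (∀ (γ : ℝ) (hγ : 0 < γ) (hγ1 : γ ≤ (min (hF ▸ 𝔠).gamma0 1) ^ 2) (K : ℕ),
                AlphaInputsT3AC.SmallFactor71OfRecT3 F (hF ▸ 𝔠) γ hγ hγ1 K) ∧
              ∀ (γ : ℝ) (hγ : 0 < γ) (hγ1 : γ ≤ (min (hF ▸ 𝔠).gamma0 1) ^ 2) (K : ℕ),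
                (∃ Ut : (k : ℕ) → GaugeField (F.P K) k (Matrix.specialUnitaryGroup (Fin 2) ℂ) →
                    GaugeField (F.P K) 0 (Matrix.specialUnitaryGroup (Fin 2) ℂ),
                  AlphaInputsT3AC.TrivMinimiserRowsT3 F (hF ▸ 𝔠) γ hγ hγ1 a₀ a₁ K Ut) →
                ∃ Ut : (k : ℕ) → GaugeField (F.P K) k (Matrix.specialUnitaryGroup (Fin 2) ℂ) →
                    GaugeField (F.P K) 0 (Matrix.specialUnitaryGroup (Fin 2) ℂ),
                  AlphaInputsT3AC.TrivMinimiserRowsT3 F (hF ▸ 𝔠) γ hγ hγ1 a₀ a₁ K Ut ∧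
                    AlphaInputsT3AC.DataRowsT3XsChiSel F (hF ▸ 𝔠) γ hγ hγ1 K Ut) :
    ∀ L : ℕ, Odd L → 1 < L → ∃ (B a₀ a₁ : ℝ), 0 < a₀ ∧ 0 < a₁ ∧ B * a₁ ≤ a₀ ∧
      (143 * ((((3 + 4 : ℕ) : ℝ)) ^ 2 / 4) ^ 2) * (2 * (B * a₁)) ≤ 1 / 3 ∧
      2 * (2 * (B * a₁)) ≤ 2 * deltaSU (Fin 2) / (((3 + 4) * L : ℕ) : ℝ) ^ 2 ∧
      1 ≤ 2 * B ∧ Thm1GlobalMinAt L a₀ a₁ B ∧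
      ∃ (b₁ p₁ : ℝ), ∀ (b₀ p₀ : ℝ), b₁ ≤ b₀ → p₁ ≤ p₀ →
        ∃ 𝔠 : AlphaConsts L (suGroupModel 2).N, 𝔠.b₀ = b₀ ∧ 𝔠.p₀ = p₀ ∧ 𝔠.B₃ = B ∧
          4 * 𝔠.B₃ * (L : ℝ) ^ 2 * avgWindowFactor L ≤ 𝔠.C68 ∧
          Real.exp (𝔠.p₀ - 1) ≤ 3 * C0 3 * 𝔠.C68 * (𝔠.b₀ * Q0 𝔠.p₀) ∧
          (𝔠.b₀ * Q0 𝔠.p₀) * (2 * (L : ℝ) ^ 2 * avgWindowFactor L) ^ 2 ≤ 3 * C0 3 * 𝔠.C68 * a₁ ^ 2 ∧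
          ∀ (F : T3Family) (hF : F.L = L),
            (∀ (γ : ℝ) (hγ : 0 < γ) (hγ1 : γ ≤ (min (hF ▸ 𝔠).gamma0 1) ^ 2) (K : ℕ),
              AlphaInputsT3AC.SmallFactor71OfRecT3 F (hF ▸ 𝔠) γ hγ hγ1 K) ∧
            AlphaInputsT3AC.OfV4ChiAt F (hF ▸ 𝔠) a₀ a₁ := by
  intro L hLo hL
  obtain ⟨a₀, a₁, B₃, ha₀, ha₁, hB₃, hT, -⟩ := hT8 L hLo hL
  obtain ⟨B₀, A₀, A₁, hA₀, hA₁, h⟩ := hrows L hLo hL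
  exact exists_B3pinned_ofV4ChiAt_of_thm1_rows hL ⟨a₀, a₁, B₃, ha₀, ha₁, hB₃, hT⟩ hA₀ hA₁ h

/-! ## §3 Consistency: forgetting `B` recovers the opaque v4 χ-socket -/

/-- ★ **FORGETTING THE `B`-LETTER RECOVERS `AlphaInputsT3ACv4RecChi L`** — §1's conclusion implies the opaque record-parametric socket (`…v4Chi.lean` :75), so this door refines,
and does not compete with, ✓`laneRecordsV4Chi_of_thm1In8_selXsDataRows_allL`. [cite: Balaban1985UV3, (7) p.257 and Thm 2 p.272; Balaban1985Variational, Thm 1 (8) p.279] -/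
theorem alphaInputsT3ACv4RecChi_of_B3pinned {L : ℕ}
    (h : ∃ (B a₀ a₁ : ℝ), 0 < a₀ ∧ 0 < a₁ ∧ B * a₁ ≤ a₀ ∧
      (143 * ((((3 + 4 : ℕ) : ℝ)) ^ 2 / 4) ^ 2) * (2 * (B * a₁)) ≤ 1 / 3 ∧
      2 * (2 * (B * a₁)) ≤ 2 * deltaSU (Fin 2) / (((3 + 4) * L : ℕ) : ℝ) ^ 2 ∧
      1 ≤ 2 * B ∧ Thm1GlobalMinAt L a₀ a₁ B ∧
      ∃ (b₁ p₁ : ℝ), ∀ (b₀ p₀ : ℝ), b₁ ≤ b₀ → p₁ ≤ p₀ →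
        ∃ 𝔠 : AlphaConsts L (suGroupModel 2).N, 𝔠.b₀ = b₀ ∧ 𝔠.p₀ = p₀ ∧ 𝔠.B₃ = B ∧
          4 * 𝔠.B₃ * (L : ℝ) ^ 2 * avgWindowFactor L ≤ 𝔠.C68 ∧
          Real.exp (𝔠.p₀ - 1) ≤ 3 * C0 3 * 𝔠.C68 * (𝔠.b₀ * Q0 𝔠.p₀) ∧
          (𝔠.b₀ * Q0 𝔠.p₀) * (2 * (L : ℝ) ^ 2 * avgWindowFactor L) ^ 2 ≤ 3 * C0 3 * 𝔠.C68 * a₁ ^ 2 ∧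
          ∀ (F : T3Family) (hF : F.L = L),
            (∀ (γ : ℝ) (hγ : 0 < γ) (hγ1 : γ ≤ (min (hF ▸ 𝔠).gamma0 1) ^ 2) (K : ℕ),
              AlphaInputsT3AC.SmallFactor71OfRecT3 F (hF ▸ 𝔠) γ hγ hγ1 K) ∧
            AlphaInputsT3AC.OfV4ChiAt F (hF ▸ 𝔠) a₀ a₁) :
    AlphaInputsT3ACv4RecChi L := by
  obtain ⟨B, a₀, a₁, ha₀, ha₁, hwin, -, -, -, -, b₁, p₁, h⟩ := h
  refine ⟨b₁, p₁, fun b₀ p₀ hb hp => ?_⟩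
  obtain ⟨𝔠, h1, h2, hB3, -, -, -, hF⟩ := h b₀ p₀ hb hp
  exact ⟨𝔠, a₀, a₁, h1, h2, ha₀, ha₁, by rw [hB3]; exact hwin, fun F hF' => (hF F hF').2⟩

end Summit.QuantumFields.YangMills.Theorems.AlphaInputsT3ACv4ChiB3Pinned

end
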